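import Literature.Topology.FourManifolds.LatticeFormsWallGeneratorsStable
import Literature.Topology.FourManifolds.LatticeFormsCharacteristic
import Mathlib.LinearAlgebra.Reflection
import Mathlib.Tactic.Module
import HarnessLib

/-!
# Characteristic vectors and the mod-4 parity of Lagrangians under Kirby's generators (Wall 1964 §2; Kirby 1989 Ch. X)

Topic `Literature/Topology/FourManifolds` (fact seat of
`Literature.Topology.FourManifolds.isHCobordant_of_equivalent_intersectionForm`, Wall's theorem
on h-cobordism: C. T. C. Wall, *On simply-connected 4-manifolds*, J. London Math. Soc. 39
(1964), Thm. 2 and §2, p. 145; R. C. Kirby, *The topology of 4-manifolds*, LNM 1374 (1989),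
Ch. X, proof of Thm. 2, pp. 58, 61–62).  In Wall's proof the Lagrangian `L` of the filling is
carried onto Wall's `K` (the graph of the isometry `α`) by a diffeomorphism realising an
automorph `T` of `H₂(∂V)`.  For an ODD lattice the words in Kirby's generators of the `S² × S²`
summands (`wallGenerators`: the handle-slide transvections `A_a`, `A'_a` with `a·a` even and
`1 ⊕ O(H)`) do NOT act transitively on the Lagrangian direct summands: this file isolates the
elementary obstruction and the device that makes it harmless.

* **Characteristic vectors** (the tree's `BilinForm.IsCharacteristic`, `LatticeFormsCharacteristic.lean`:
  `v·x ≡ x·x (mod 2)`; existence `exists_isCharacteristic` and uniqueness mod `2W`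
  `IsCharacteristic.exists_eq_add_two_smul` are proved there): here only the instance-general
  existence `exists_isCharacteristic_of_module` (any `ℤ`-module structure, as on `H²(M; ℤ)/T`) and
  preservation under SIGN-CHANGING isometric surjections (`isCharacteristic_of_surjective`).
* **The parity relation**: for characteristic ISOTROPIC `v`, `v''` the residue of `v·v'' / 2`
  mod `2`.  Every Kirby generator `s`, hence every word `φ` in them, moves a characteristic vector
  `v` to `φ v = v + (c + c)` with `c·c` even (`exists_eq_add_add_of_isWordIn`), so `4 ∣ v · φ v`
  for isotropic `v` (`four_dvd_apply_of_isWordIn`) — the β-mod-4 invariant of the odd programme —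
  and the relation is constant along an isotropic submodule (`four_dvd_iff_of_mem_isotropic`).
* **Graphs**: Wall's `K = graph α ⊆ H²(M₁)/T ⊕ H²(M₂)/T` contains the characteristic isotropic
  vector `(w, αw)` (`exists_isCharacteristic_mem_graph`); replacing `α` by `α ∘ τ` with `τ` the
  REFLECTION in a vector `z` of norm `η = ±1` (`unitReflectionEquiv`, an isometry) changes the
  class: `(w, αw)·(w, ταw) = 2η (z·αw)²` with `z·αw ≡ z·z` odd, NOT divisible by `4`
  (`not_four_dvd_graph_graph_reflection`).  So the two graphs lie in the two mod-4 classes; which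
  of them the filling's Lagrangian meets is settled downstream (the Lagrangian mover of Wall's trick
  for odd forms), where the conclusion of Wall's theorem — h-cobordism — does not depend on the
  isometry used.

Everything is proved; the only definition is the reflection (Mathlib's `Module.reflection`);
no named fact is introduced (D-0026).

## References

* C. T. C. Wall, *On simply-connected 4-manifolds*, J. London Math. Soc. 39 (1964) 141–149,
  Thm. 2, §2 p. 145. [WallJLMS1964]
* R. C. Kirby, *The topology of 4-manifolds*, LNM 1374 (1989), Ch. X, proof of Thm. 2, p. 58
  ("if `Q_M` is odd … complex conjugation on `ℂP²`") and pp. 61–62. [Kirby1989]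
* J. Milnor, D. Husemoller, *Symmetric bilinear forms* (1973), Ch. II §5 (characteristic
  elements, `v·x ≡ x·x`). [MilnorHusemoller1973]
-/

noncomputable section

open Module
open LinearMap (BilinForm)

namespace Literature.Topology.FourManifolds

/-! ### Characteristic vectors -/

section Characteristic

variable {W : Type*} [AddCommGroup W]

/-- **Characteristic vectors exist in a unimodular lattice, for any `ℤ`-module structure** — the
tree's `exists_isCharacteristic` (Kirby II §3 Lemma 3.3; `LatticeFormsCharacteristic.lean`, stated
for the canonical `ℤ`-module structure of an additive group) transported to an arbitrary `Module ℤ`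
instance, as carried by `H²(M; ℤ)/T` (all such instances coincide). [cite: Kirby1989, Ch. II §3, Lemma 3.3 (pp. 25–26)] -/
theorem exists_isCharacteristic_of_module [inst : Module ℤ W] [Module.Finite ℤ W] [Module.Free ℤ W]
    {B : BilinForm ℤ W} (hB : B.IsSymm) (hU : B.IsUnimodular) : ∃ w : W, B.IsCharacteristic w := by
  obtain rfl : inst = AddCommGroup.toIntModule W := Subsingleton.elim _ _
  exact LinearMap.BilinForm.exists_isCharacteristic hB hU

/-- Unfolding of characteristic-ness in the order used below: `2 ∣ v·x - x·x`. [folklore] -/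
theorem _root_.LinearMap.BilinForm.IsCharacteristic.two_dvd_sub [Module ℤ W] {B : BilinForm ℤ W} {v : W} (hv : B.IsCharacteristic v)
    (x : W) : (2 : ℤ) ∣ B v x - B x x := by
  rw [dvd_sub_comm]; exact (hv x).dvd

/-- The converse unfolding. [folklore] -/
theorem isCharacteristic_of_two_dvd_sub [Module ℤ W] {B : BilinForm ℤ W} {v : W}
    (hv : ∀ x, (2 : ℤ) ∣ B v x - B x x) : B.IsCharacteristic v :=
  (LinearMap.BilinForm.isCharacteristic_iff_dvd B v).2 fun x => by rw [dvd_sub_comm]; exact hv x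

variable [Module ℤ W] {B : BilinForm ℤ W}

/-- A SIGN-CHANGING isometric surjection (`B' (θ x) (θ y) = d · B x y`, any `d`) carries
characteristic vectors to characteristic vectors (for `d = 1` and a bijection this is the tree's
`IsCharacteristic.map`). [folklore] -/
theorem isCharacteristic_of_surjective {W' : Type*} [AddCommGroup W'] [Module ℤ W'] {B' : BilinForm ℤ W'}
    (θ : W →ₗ[ℤ] W') (hθ : Function.Surjective θ) (d : ℤ) (hform : ∀ x y, B' (θ x) (θ y) = d * B x y)
    {v : W} (hv : B.IsCharacteristic v) : B'.IsCharacteristic (θ v) := by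
  refine isCharacteristic_of_two_dvd_sub fun y => ?_
  obtain ⟨x, rfl⟩ := hθ y
  rw [hform, hform, ← mul_sub]
  exact (hv.two_dvd_sub x).mul_left d

/-- Divisibility by `4` of a pairing is invariant under a sign-changing isometry. [folklore] -/
theorem four_dvd_map_iff {W' : Type*} [AddCommGroup W'] [Module ℤ W'] {B' : BilinForm ℤ W'}
    (θ : W →ₗ[ℤ] W') (d : ℤ) (hd : d = 1 ∨ d = -1) (hform : ∀ x y, B' (θ x) (θ y) = d * B x y)
    (v v' : W) : (4 : ℤ) ∣ B' (θ v) (θ v') ↔ (4 : ℤ) ∣ B v v' := by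
  rw [hform]
  rcases hd with rfl | rfl
  · rw [one_mul]
  · rw [neg_one_mul, dvd_neg]

/-! ### The parity relation along an isotropic submodule -/

omit [Module ℤ W] in
/-- **The relation is constant along an isotropic submodule**: for characteristic `v''`, `u` in a
submodule on which `B` vanishes, and any characteristic isotropic `v`,
`4 ∣ v·v'' ↔ 4 ∣ v·u` (`v'' - u = a + a` with `a` isotropic, and `v·a ≡ a·a = 0`).  Any
`ℤ`-module structure. [cite: WallJLMS1964, §2, p. 145] -/
theorem four_dvd_iff_of_mem_isotropic [inst : Module ℤ W] {B : BilinForm ℤ W}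
    (hU : B.IsUnimodular) {S : Submodule ℤ W} (hS : ∀ x ∈ S, ∀ y ∈ S, B x y = 0)
    {v v'' u : W} (hv : B.IsCharacteristic v) (hv'' : B.IsCharacteristic v'')
    (hu : B.IsCharacteristic u) (hv''S : v'' ∈ S) (huS : u ∈ S) :
    (4 : ℤ) ∣ B v v'' ↔ (4 : ℤ) ∣ B v u := by
  obtain rfl : inst = AddCommGroup.toIntModule W := Subsingleton.elim _ _
  obtain ⟨a, ha⟩ := hu.exists_eq_add_two_smul hU hv''
  -- `a` is isotropic: `4 a·a = (v'' - u)·(v'' - u) = 0`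
  have haa : B a a = 0 := by
    have h0 : B (v'' - u) (v'' - u) = 0 := by
      simp only [map_sub, LinearMap.sub_apply]
      rw [hS _ hv''S _ hv''S, hS _ hv''S _ huS, hS _ huS _ hv''S, hS _ huS _ huS, sub_zero, sub_zero]
    rw [ha, add_sub_cancel_left, LinearMap.BilinForm.smul_left, LinearMap.BilinForm.smul_right] at h0
    have : (4 : ℤ) * B a a = 0 := by linear_combination h0
    exact (mul_eq_zero.1 this).resolve_left (by norm_num)
  -- `v·v'' = v·u + 2 v·a` and `v·a ≡ a·a = 0`
  have hva : (2 : ℤ) ∣ B v a := by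
    have h := hv.two_dvd_sub a; rwa [haa, sub_zero] at h
  have hsplit : B v v'' = B v u + 2 * B v a := by
    rw [ha, map_add, LinearMap.BilinForm.smul_right]
  rw [hsplit]
  obtain ⟨k, hk⟩ := hva
  rw [hk, show B v u + 2 * (2 * k) = B v u + 4 * k by ring]
  constructor
  · intro h; have := dvd_sub h (dvd_mul_right 4 k); rwa [add_sub_cancel_right] at this
  · intro h; exact dvd_add h (dvd_mul_right 4 k)

end Characteristic

/-! ### Kirby's generators move characteristic vectors by `c + c`, `c·c` even -/

section Generators

variable {V : Type*} [AddCommGroup V] {Q : BilinForm ℤ V}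

/-- Local notation for the form `Q ⊕ H` on `V × (Fin 2 → ℤ)`. -/
local notation "QH" => (Q.prod hyperbolicForm)

/-- **Every Kirby generator moves a characteristic vector by twice a vector of even square**:
for `A_a` (`a·a = 2q`), `A_a v - v = λ a - (μ + qλ) y` with `λ = y·v` and `μ = a·v` both even
(`v` characteristic, `y` and `a` of even square), and `c = (λ/2) a - ((μ + qλ)/2) y` has
`c·c = (λ/2)² 2q`; for `1 ⊕ g` the `H`-coordinates of `v` are even and `H` is even.
[cite: Kirby1989, Ch. X, proof of Thm. 2 (pp. 61–62)] -/
theorem exists_eq_add_add_of_mem_wallGenerators (hQ : Q.IsSymm)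
    {s : (QH).IsometryEquiv QH} (hs : s ∈ wallGenerators hQ) {v : V × (Fin 2 → ℤ)}
    (hvc : (QH).IsCharacteristic v) :
    ∃ c : V × (Fin 2 → ℤ), s v = v + (c + c) ∧ (2 : ℤ) ∣ QH c c := by
  have hB : (QH).IsSymm := hQ.prod isSymm_hyperbolicForm
  have hv : ∀ x, (2 : ℤ) ∣ QH v x - QH x x := hvc.two_dvd_sub
  -- the `H`-coordinates of `v` are even
  have hlam : (2 : ℤ) ∣ QH hypY v := by
    have h := hv hypY; rwa [prod_hyperbolic_hypY_hypY, sub_zero, hB.eq] at h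
  have hlam' : (2 : ℤ) ∣ QH hypX v := by
    have h := hv hypX; rwa [prod_hyperbolic_hypX_hypX, sub_zero, hB.eq] at h
  rcases hs with ⟨a, q, hq, rfl⟩ | ⟨a, q, hq, rfl⟩ | ⟨g, rfl⟩
  · -- `A_a`
    have hμ : (2 : ℤ) ∣ QH ((a, 0) : V × (Fin 2 → ℤ)) v := by
      have h := hv (a, 0)
      rw [prod_hyperbolic_inl_inl, hq, hB.eq] at h
      have h2 : (2 : ℤ) ∣ q + q := ⟨q, by ring⟩
      simpa using dvd_add h h2
    obtain ⟨l, hl⟩ := hlam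
    obtain ⟨m, hm⟩ := hμ
    refine ⟨l • ((a, 0) : V × (Fin 2 → ℤ)) - (m + q * l) • hypY, ?_, ?_⟩
    · rw [transvectionAEquiv_apply, transvectionA, LinearMap.BilinForm.eichlerTransvection_apply, hl, hm]
      module
    · simp only [map_sub, map_smul, LinearMap.sub_apply, LinearMap.smul_apply, smul_eq_mul,
        prod_hyperbolic_inl_inl, prod_hyperbolic_inl_hypY, prod_hyperbolic_hypY_inl,
        prod_hyperbolic_hypY_hypY, hq]
      exact ⟨l * l * q, by ring⟩
  · -- `A'_a`
    have hμ : (2 : ℤ) ∣ QH ((a, 0) : V × (Fin 2 → ℤ)) v := by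
      have h := hv (a, 0)
      rw [prod_hyperbolic_inl_inl, hq, hB.eq] at h
      have h2 : (2 : ℤ) ∣ q + q := ⟨q, by ring⟩
      simpa using dvd_add h h2
    obtain ⟨l, hl⟩ := hlam'
    obtain ⟨m, hm⟩ := hμ
    refine ⟨l • ((a, 0) : V × (Fin 2 → ℤ)) - (m + q * l) • hypX, ?_, ?_⟩
    · rw [transvectionA'Equiv_apply, transvectionA', LinearMap.BilinForm.eichlerTransvection_apply, hl,
        hm]
      module
    · simp only [map_sub, map_smul, LinearMap.sub_apply, LinearMap.smul_apply, smul_eq_mul,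
        prod_hyperbolic_inl_inl, prod_hyperbolic_inl_hypX, prod_hyperbolic_hypX_inl,
        prod_hyperbolic_hypX_hypX, hq]
      exact ⟨l * l * q, by ring⟩
  · -- `1 ⊕ g`
    obtain ⟨l, hl⟩ := hlam
    obtain ⟨m, hm⟩ := hlam'
    set u : Fin 2 → ℤ := ![l, m] with hu
    have hv2 : v.2 = u + u := by
      have h0 : v.2 0 = 2 * l := by rw [← hl, hB.eq, prod_hyperbolic_apply_hypY]
      have h1 : v.2 1 = 2 * m := by rw [← hm, hB.eq, prod_hyperbolic_apply_hypX]
      ext i; fin_cases i <;> simp [hu, h0, h1] <;> ring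
    refine ⟨((0 : V), g u - u), ?_, ?_⟩
    · rw [LinearMap.BilinForm.IsometryEquiv.prodCongr_apply]
      refine Prod.ext ?_ ?_
      · change v.1 = v.1 + (0 + 0); rw [add_zero, add_zero]
      · change g v.2 = v.2 + ((g u - u) + (g u - u))
        rw [hv2, map_add]; abel
    · have h : QH ((0 : V), g u - u) ((0 : V), g u - u) = hyperbolicForm (g u - u) (g u - u) := by
        rw [LinearMap.BilinForm.prod_apply]; simp
      rw [h, hyperbolicForm_apply_self]
      exact dvd_mul_right 2 _

/-- **Every word in Kirby's generators moves a characteristic vector by twice a vector of even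
square** (composition: `c'' = c + c'`, `c''·c'' ≡ c·c + c'·c'`; inverses: `-c`).
[cite: Kirby1989, Ch. X, proof of Thm. 2 (pp. 61–62)] -/
theorem exists_eq_add_add_of_isWordIn (hQ : Q.IsSymm) {φ : (QH).IsometryEquiv QH}
    (hφ : IsWordIn (wallGenerators hQ) φ) :
    ∀ v : V × (Fin 2 → ℤ), (QH).IsCharacteristic v →
      ∃ c : V × (Fin 2 → ℤ), φ v = v + (c + c) ∧ (2 : ℤ) ∣ QH c c := by
  have hB : (QH).IsSymm := hQ.prod isSymm_hyperbolicForm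
  -- the property, and its closure under inverses and composition
  let P : (QH).IsometryEquiv QH → Prop := fun ψ =>
    ∀ v : V × (Fin 2 → ℤ), (QH).IsCharacteristic v →
      ∃ c : V × (Fin 2 → ℤ), ψ v = v + (c + c) ∧ (2 : ℤ) ∣ QH c c
  have hsymm : ∀ ψ, P ψ → P ψ.symm := by
    intro ψ hψ v hv
    obtain ⟨c, hc, hcc⟩ := hψ (ψ.symm v) (hv.map ψ.symm)
    rw [LinearMap.BilinForm.IsometryEquiv.apply_symm_apply] at hc
    refine ⟨-c, ?_, ?_⟩
    · rw [eq_sub_of_add_eq hc.symm]; abel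
    · simpa only [map_neg, LinearMap.neg_apply, neg_neg] using hcc
  have htrans : ∀ ψ χ, P ψ → P χ → P (ψ.trans χ) := by
    intro ψ χ hψ hχ v hv
    obtain ⟨c, hc, hcc⟩ := hψ v hv
    obtain ⟨c', hc', hc'c'⟩ := hχ (ψ v) (hv.map ψ)
    refine ⟨c + c', ?_, ?_⟩
    · rw [LinearMap.BilinForm.IsometryEquiv.trans_apply, hc', hc]; abel
    · have h : QH (c + c') (c + c') = QH c c + QH c' c' + 2 * QH c c' := by
        simp only [map_add, LinearMap.add_apply]
        rw [hB.eq c' c]; ring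
      rw [h]
      exact dvd_add (dvd_add hcc hc'c') (dvd_mul_right 2 _)
  have hgen : ∀ ψ, ψ ∈ wallGenerators hQ ∨ ψ.symm ∈ wallGenerators hQ → P ψ := by
    rintro ψ (h | h)
    · exact fun v hv => exists_eq_add_add_of_mem_wallGenerators hQ h hv
    · have h' := hsymm _ (fun v hv => exists_eq_add_add_of_mem_wallGenerators hQ h hv)
      rwa [LinearMap.BilinForm.IsometryEquiv.symm_symm] at h'
  -- induction on the word
  obtain ⟨l, hl, hlφ⟩ := hφ
  have hword : ∀ l : List ((QH).IsometryEquiv QH),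
      (∀ ψ ∈ l, ψ ∈ wallGenerators hQ ∨ ψ.symm ∈ wallGenerators hQ) → P (wordProd l) := by
    intro l
    induction l with
    | nil =>
      intro _ v _
      exact ⟨0, by simp [wordProd_nil, LinearMap.BilinForm.IsometryEquiv.refl_apply], by simp⟩
    | cons ψ l ih =>
      intro hl
      rw [wordProd_cons]
      exact htrans _ _ (hgen ψ (hl ψ List.mem_cons_self))
        (ih fun χ hχ => hl χ (List.mem_cons_of_mem ψ hχ))
  intro v hv
  obtain ⟨c, hc, hcc⟩ := hword l hl v hv
  exact ⟨c, by rw [← hlφ v]; exact hc, hcc⟩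

/-- **Words in Kirby's generators preserve the mod-4 class of a characteristic isotropic vector**:
`4 ∣ v · φ v` (`v · (v + 2c) = 2 v·c ≡ 2 c·c ≡ 0 (mod 4)`).
[cite: WallJLMS1964, §2, p. 145] [cite: Kirby1989, Ch. X, proof of Thm. 2 (pp. 61–62)] -/
theorem four_dvd_apply_of_isWordIn (hQ : Q.IsSymm) {φ : (QH).IsometryEquiv QH}
    (hφ : IsWordIn (wallGenerators hQ) φ) {v : V × (Fin 2 → ℤ)}
    (hv : (QH).IsCharacteristic v) (hvv : QH v v = 0) : (4 : ℤ) ∣ QH v (φ v) := by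
  obtain ⟨c, hc, hcc⟩ := exists_eq_add_add_of_isWordIn hQ hφ v hv
  have hvc : (2 : ℤ) ∣ QH v c := by
    have h := hv.two_dvd_sub c
    obtain ⟨k, hk⟩ := hcc
    obtain ⟨k', hk'⟩ := h
    exact ⟨k' + k, by linear_combination hk' + hk⟩
  obtain ⟨k, hk⟩ := hvc
  rw [hc, map_add, map_add, hvv, zero_add, hk]
  exact ⟨k, by ring⟩

end Generators

/-! ### Reflections in vectors of norm `±1`, and the two graphs -/

section Reflection

variable {R : Type*} [CommRing R] {W : Type*} [AddCommGroup W] [Module R W] {B : BilinForm R W}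

/-- The coroot condition of Mathlib's `Module.reflection` for a vector of norm `η = ±1`:
`((2η) • B z) z = 2`. [folklore] -/
theorem two_mul_smul_apply_self_eq_two {z : W} {η : R} (hz : B z z = η) (hη : η * η = 1) :
    ((2 * η) • B z) z = 2 := by
  rw [LinearMap.smul_apply, hz, smul_eq_mul, mul_assoc, hη, mul_one]

/-- **The reflection in a vector `z` of norm `η = ±1`**, `v ↦ v - 2η (z·v) z`, an isometric
involution of `(W, B)` (Mathlib's `Module.reflection` with the root `z` and coroot `2η (z·-)`) —
on `H²(ℂP²; ℤ) ⊕ …` the reflection in the generator is induced by complex conjugation (Kirby,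
p. 58), but here it is only used abstractly, to change the isometry `α`.  Any commutative ring of
scalars. [cite: Kirby1989, Ch. X, proof of Thm. 2 (p. 58)] -/
def unitReflectionEquiv (hB : B.IsSymm) (z : W) (η : R) (hz : B z z = η) (hη : η * η = 1) :
    B.IsometryEquiv B :=
  { Module.reflection (two_mul_smul_apply_self_eq_two hz hη) with
    map_app' := fun v w => by
      change B (Module.preReflection z ((2 * η) • B z) v) (Module.preReflection z ((2 * η) • B z) w) =
        B v w
      simp only [Module.preReflection_apply, LinearMap.smul_apply, smul_eq_mul, map_sub, map_smul,
        LinearMap.sub_apply, hz, hB.eq v z]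
      linear_combination (4 * B z v * B z w * η) * hη }

/-- The formula of the reflection: `τ_z v = v - (2η (z·v)) z`. [folklore] -/
theorem unitReflectionEquiv_apply (hB : B.IsSymm) (z : W) (η : R) (hz : B z z = η) (hη : η * η = 1)
    (v : W) : unitReflectionEquiv hB z η hz hη v = v - (2 * η * B z v) • z := by
  change Module.preReflection z ((2 * η) • B z) v = _
  rw [Module.preReflection_apply, LinearMap.smul_apply, smul_eq_mul]

/-- **Pairings with a reflected vector**: `y · τ_z v = y·v - 2η (z·v)(y·z)`. [folklore] -/
theorem apply_unitReflectionEquiv (hB : B.IsSymm) (z : W) (η : R) (hz : B z z = η) (hη : η * η = 1)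
    (y v : W) : B y (unitReflectionEquiv hB z η hz hη v) = B y v - 2 * η * B z v * B y z := by
  rw [unitReflectionEquiv_apply, map_sub, map_smul, smul_eq_mul, mul_comm (2 * η * B z v) (B y z),
    mul_assoc]

end Reflection

section ReflectionInt

variable {W : Type*} [AddCommGroup W] [Module ℤ W] {B : BilinForm ℤ W}

/-- **A characteristic vector pairs oddly with a vector of norm `±1`.** [folklore] -/
theorem odd_apply_of_isCharacteristic {v z : W} (hv : B.IsCharacteristic v) {η : ℤ}
    (hz : B z z = η) (hη : η * η = 1) : Odd (B v z) := by
  have hηodd : Odd η := by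
    rcases Int.eq_one_or_neg_one_of_mul_eq_one hη with rfl | rfl <;> decide
  have h := hv.two_dvd_sub z
  rw [hz] at h
  obtain ⟨k, hk⟩ := h
  rw [show B v z = η + 2 * k by linear_combination hk]
  exact hηodd.add_even (even_two_mul k)

end ReflectionInt

section Graph

variable {V₁ V₂ W : Type*} [AddCommGroup V₁] [Module ℤ V₁] [AddCommGroup V₂] [Module ℤ V₂]
  [AddCommGroup W] [Module ℤ W]
  {Q₁ : BilinForm ℤ V₁} {Q₂ : BilinForm ℤ V₂} {B : BilinForm ℤ W}
  {s : W →ₗ[ℤ] V₁} {t : W →ₗ[ℤ] V₂}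

/-- **Wall's graph contains a characteristic isotropic vector**: if `W` decomposes as
`V₁ ⊕ V₂` with `B = Q₁ ⊕ (−Q₂)` and `e : Q₁ ≅ Q₂`, then for `w` characteristic for `Q₁` the
vector `x` with coordinates `(w, e w)` lies in the graph of `e` (`t x = e (s x)`), is
characteristic for `B` and isotropic. [cite: WallJLMS1964, §2, pp. 144–145] -/
theorem exists_isCharacteristic_mem_graph (hst : Function.Bijective fun x => (s x, t x))
    (hB : ∀ x y, B x y = Q₁ (s x) (s y) - Q₂ (t x) (t y)) (e : Q₁.IsometryEquiv Q₂) {w : V₁}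
    (hw : Q₁.IsCharacteristic w) :
    ∃ x : W, s x = w ∧ t x = e w ∧ B.IsCharacteristic x ∧ B x x = 0 := by
  obtain ⟨x, hx⟩ := hst.2 (w, e w)
  have hsx : s x = w := congrArg Prod.fst hx
  have htx : t x = e w := congrArg Prod.snd hx
  refine ⟨x, hsx, htx, isCharacteristic_of_two_dvd_sub fun y => ?_, ?_⟩
  · rw [hB, hB, hsx, htx]
    have h1 := hw.two_dvd_sub (s y)
    have h2 : (2 : ℤ) ∣ Q₂ (e w) (t y) - Q₂ (t y) (t y) := (hw.map e).two_dvd_sub (t y)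
    rw [show Q₁ w (s y) - Q₂ (e w) (t y) - (Q₁ (s y) (s y) - Q₂ (t y) (t y)) =
      (Q₁ w (s y) - Q₁ (s y) (s y)) - (Q₂ (e w) (t y) - Q₂ (t y) (t y)) by ring]
    exact dvd_sub h1 h2
  · rw [hB, hsx, htx, e.map_app, sub_self]

/-- **The two graphs `graph e` and `graph (e ∘ τ)`, `τ` the reflection in a vector of norm `±1`,
lie in different mod-4 classes**: for `w` characteristic for `Q₁`, the graph vectors `x = (w, e w)`
and `x' = (w, τ (e w))` have `x·x' = 2η (z · e w)²` with `z · e w` odd, so `4 ∤ x·x'`.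
[cite: Kirby1989, Ch. X, proof of Thm. 2 (p. 58)] [cite: WallJLMS1964, §2, p. 145] -/
theorem not_four_dvd_graph_graph_reflection (hB : ∀ x y, B x y = Q₁ (s x) (s y) - Q₂ (t x) (t y))
    (hQ₂ : Q₂.IsSymm) (e : Q₁.IsometryEquiv Q₂) {z : V₂} {η : ℤ} (hz : Q₂ z z = η)
    (hη : η * η = 1) {w : V₁} (hw : Q₁.IsCharacteristic w) {x x' : W}
    (hsx : s x = w) (htx : t x = e w) (hsx' : s x' = w)
    (htx' : t x' = unitReflectionEquiv hQ₂ z η hz hη (e w)) : ¬ (4 : ℤ) ∣ B x x' := by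
  -- `x·x' = 2η (z·ew)²`
  have hpair : B x x' = 2 * η * (Q₂ z (e w) * Q₂ z (e w)) := by
    rw [hB, hsx, htx, hsx', htx', apply_unitReflectionEquiv, ← e.map_app w w, hQ₂.eq (e w) z]
    ring
  -- `z · e w` is odd
  have hodd : Odd (Q₂ z (e w)) := by
    rw [hQ₂.eq]
    exact odd_apply_of_isCharacteristic (hw.map e) hz hη
  have hηodd : Odd η := by
    rcases Int.eq_one_or_neg_one_of_mul_eq_one hη with rfl | rfl <;> decide
  rw [hpair]
  rintro ⟨k, hk⟩
  have h2' : (2 : ℤ) * (η * (Q₂ z (e w) * Q₂ z (e w)) - 2 * k) = 0 := by linear_combination hk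
  have h2 : η * (Q₂ z (e w) * Q₂ z (e w)) = 2 * k := by
    linear_combination (mul_eq_zero.1 h2').resolve_left two_ne_zero
  have hodd' : Odd (η * (Q₂ z (e w) * Q₂ z (e w))) := hηodd.mul (hodd.mul hodd)
  rw [h2] at hodd'
  exact (Int.not_even_iff_odd.2 hodd') (even_two_mul k)

end Graph

end Literature.Topology.FourManifolds

end
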